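import Summits.BirchSwinnertonDyer.BirchSwinnertonDyer.Theorems.AlignedTransportAtTwoMainConjectureTransportAlignedAtTwoDeltaPosGaloisPlane
import Summits.BirchSwinnertonDyer.BirchSwinnertonDyer.Theorems.AlignedTransportAtTwoMainConjectureTransportAlignedAtTwoDeltaPosFourCosets
import Summits.BirchSwinnertonDyer.BirchSwinnertonDyer.Theorems.AlignedTransportAtTwoMainConjectureTransportAlignedAtTwoDeltaPosPointLink
import Summits.BirchSwinnertonDyer.BirchSwinnertonDyer.Theorems.AlignedTransportAtTwoMainConjectureTransportAlignedAtTwoDeltaPosFunctional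
import HarnessLib

/-!
# Crux C1 `MainConjectureTransportAlignedAtTwo` (stmt-BirchSwinnertonDyer-22296), line `birth`, plan «deltapos-galois» step (G1c):
# THE GALOIS PLANE ON THE JACOBIAN — with the `ℚ`-structure carrier `J : ModularJacobianGaloisData N ι` (typing ask T1), the two modular
# parametrisations of an equal-conductor congruent `S₃` pair off the Kilford stratum transport half-classes `[x/2] ∈ J₀(N)[2]` to `2`-torsion points
# of `W₁`, `W₂` over `ℚ̄` that DIFFER BY THE equivariant isomorphism of the shared cubic field (lead att-p1 g10; `--supports 22296`)

THEOREMS ONLY (no `def`, no `sorry`, no named fact). CONDITIONAL on a carrier instance `J : ModularJacobianGaloisData N ι` (hypothesis; its existence is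
the PRINT fact «`J₀(N)` and the modular parametrisations are defined over `ℚ`», DDT 1995 §1.5/§1.7 — ask T1) and on the PRINT Hecke pair `hSD`, `hBz`.
BSD is not proved by this; C1 is not closed by this.

* §1 `exists_T_geomPointsToComplex_eq` — every non-zero `2`-torsion point of `W(ℂ)` is the image under `ι` of a letter `T W i ∈ W[2](ℚ̄)` (the complex
  `2`-division cubic is the `ι`-image of the `ℚ̄` one, whose roots are the three `xT W i`; `…DeltaPosPointLink.eq_of_X_eq_of_two_torsion`);
  `existsUnique_geomTorsion_eq` — hence every `2`-torsion point of `W(ℂ)` is `geomPointsToComplex ι P` for a UNIQUE `P ∈ W[2](ℚ̄)`.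
* §2 **`jacobiMap_half_transport`** — MAIN: `J : ModularJacobianGaloisData N ι`; `D₁ D₂` parametrisation data at the SAME level `N` (odd) for `W₁ W₂`
  (globally minimal, no rational `2`-torsion abscissa, `Δ(Wᵢ) ∉ ℚ₂²`, good reduction away from `2N`, sharing a cubic field); `a_q(W₁) ≡ a_q(W₂) (mod 2)`
  for every prime `q` (hypothesis `hpar`); both maps non-zero on some half-class (hypotheses `hnz₁ hnz₂`, supplied by the `μ = 0` theorem through
  `…DeltaPosFunctional`). THEN for every `x ∈ Λ = periodHomology N` and `P₁ ∈ W₁[2](ℚ̄)` with `D₁.jacobiMap [x/2] = geomPointsToComplex ι P₁`: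
  `D₂.jacobiMap [x/2] = geomPointsToComplex ι (e P₁)`, `e` THE equivariant iso (`…SharedCubicTorsionUnique`). Proof: the maps `θᵢ : Λ → Wᵢ[2]`,
  `x ↦` (the `P` with `geomPointsToComplex ι P = Dᵢ.jacobiMap [x/2]`) are additive, equivariant for the lifted action (`jacobiMap_galAct`), kill
  `K := ker θ₁ ⊓ ker θ₂ ⊇ 2Λ + Σ_q (T_q^∨ − a_q)Λ` (Hecke eigen-relation + `hpar`), of index `≤ 4` (`…DeltaPosFourCosets`), and are non-zero — so
  `…DeltaPosGaloisPlane.comp_eq_of_sharedCubicField` applies.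

References: Darmon–Diamond–Taylor 1995 §1.3, §1.5, §1.7 [DarmonDiamondTaylor1995]; Buzzard 2000 Prop. 2.4 [Buzzard2000LevelLoweringModTwo];
Silverman AEC III.§7, VI.5 [SilvermanAEC2009].
-/

noncomputable section

-- justification: the `Summit.BirchSwinnertonDyer.BirchSwinnertonDyer.…` path repeats a component (route-file convention)
set_option linter.dupNamespace false
set_option autoImplicit false

open scoped MatrixGroups ModularForm NumberField Classical
open CongruenceSubgroup Complex WeierstrassCurve IsDedekindDomain Polynomial Module
open Literature.NumberTheory.EllipticCurves Literature.NumberTheory.EllipticCurves.ModularForms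
open Literature.NumberTheory.EllipticCurves.Greenberg1999
open Literature.NumberTheory.EllipticCurves.DokchitserDokchitser2012
open Rat.HeightOneSpectrum
open Summit.BirchSwinnertonDyer.Rank1Residual.F1Sign2
open Summit.BirchSwinnertonDyer.BirchSwinnertonDyer.Theorems.AlignedTransportAtTwoDeltaPosGaloisPlane
open Summit.BirchSwinnertonDyer.BirchSwinnertonDyer.Theorems.AlignedTransportAtTwoDeltaPosFourCosets
open Summit.BirchSwinnertonDyer.BirchSwinnertonDyer.Theorems.AlignedTransportAtTwoDeltaPosPointLink

namespace Summit.BirchSwinnertonDyer.BirchSwinnertonDyer.Theorems.AlignedTransportAtTwoDeltaPosJacobian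

/-! ## §1 Complex `2`-torsion points come from `W[2](ℚ̄)` -/

section Algebraicity

variable (W : WeierstrassCurve ℚ) [W.IsElliptic] (ι : AlgebraicClosure ℚ →+* ℂ)

omit [W.IsElliptic] in
/-- The complex `2`-division cubic is the `ι`-image of the `ℚ̄` one. [folklore] -/
theorem twoTorsionPolynomial_baseChange_complex :
    (W.baseChange ℂ).twoTorsionPolynomial.toPoly =
      ((Cubic.map (algebraMap ℚ (AlgebraicClosure ℚ)) W.twoTorsionPolynomial).toPoly).map ι := by
  rw [← Cubic.map_toPoly, Cubic.map, Cubic.map]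
  simp only [twoTorsionPolynomial, baseChange, map_b₂, map_b₄, map_b₆, map_ofNat, map_mul, eq_ratCast, map_ratCast]

/-- **Every non-zero `2`-torsion point of `W(ℂ)` is the `ι`-image of one of the letters `T W i`.** [cite: SilvermanAEC2009, Cor. III.6.4(b), Ex. III.3.7 (d)] -/
theorem exists_T_geomPointsToComplex_eq {Q : (W.baseChange ℂ).toAffine.Point} (hQ0 : Q ≠ 0) (hQ : Q + Q = 0) :
    ∃ i : Fin 3, W.geomPointsToComplex ι (T W two_ne_zero i : W.geomPoints) = Q := by
  rcases Q with _ | ⟨x, y, h⟩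
  · exact absurd rfl hQ0
  -- `x` is a root of the complex `2`-division cubic, i.e. of the `ι`-image of the `ℚ̄` cubic
  have hroot := ((W.baseChange ℂ).isRoot_twoTorsionPolynomial_of_add_self_eq_zero hQ).2
  rw [twoTorsionPolynomial_baseChange_complex W ι] at hroot
  set p : (AlgebraicClosure ℚ)[X] := (Cubic.map (algebraMap ℚ (AlgebraicClosure ℚ)) W.twoTorsionPolynomial).toPoly with hp
  have ha : (Cubic.map (algebraMap ℚ (AlgebraicClosure ℚ)) W.twoTorsionPolynomial).a ≠ 0 := by
    change algebraMap ℚ (AlgebraicClosure ℚ) 4 ≠ 0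
    rw [map_ofNat]; norm_num
  have hp0 : p ≠ 0 := Cubic.ne_zero_of_a_ne_zero ha
  have hdeg : p.natDegree = 3 := Cubic.natDegree_of_a_ne_zero ha
  have hroots : p.roots = {xT W two_ne_zero 0, xT W two_ne_zero 1, xT W two_ne_zero 2} :=
    roots_twoTorsionPolynomial W two_ne_zero
  have hcard : Multiset.card p.roots = p.natDegree := by
    rw [hroots, hdeg]; simp
  have hmap : (p.map ι).roots = p.roots.map ι := (roots_map_of_injective_of_card_eq_natDegree ι.injective hcard).symm
  have hx : x ∈ (p.map ι).roots := (mem_roots ((Polynomial.map_ne_zero_iff ι.injective).mpr hp0)).mpr hroot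
  rw [hmap, hroots] at hx
  simp only [Multiset.insert_eq_cons, Multiset.map_cons, Multiset.map_singleton, Multiset.mem_cons, Multiset.mem_singleton] at hx
  -- the letter `i` with `ι (xT i) = x`
  have key : ∀ i : Fin 3, x = ι (xT W two_ne_zero i) →
      W.geomPointsToComplex ι (T W two_ne_zero i : W.geomPoints) = Affine.Point.some x y h := by
    intro i hi
    have hT0 := coe_T_ne_zero W two_ne_zero i
    have h2T : (2 : ℕ) • (W.geomPointsToComplex ι (T W two_ne_zero i : W.geomPoints)) = 0 := by
      rw [← map_nsmul, two_nsmul, coe_add_self_eq_zero, map_zero]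
    -- write `T i = (xT i, y')`
    generalize hTi : (T W two_ne_zero i : W.geomPoints) = Ti at hT0 h2T
    change (W.baseChange (AlgebraicClosure ℚ)).toAffine.Point at Ti
    rcases Ti with _ | ⟨x', y', h'⟩
    · exact absurd rfl hT0
    · have hx' : x' = xT W two_ne_zero i := by
        have : xco W (T W two_ne_zero i : W.geomPoints) = xT W two_ne_zero i := rfl
        rw [hTi] at this; exact this
      rw [WeierstrassCurve.geomPointsToComplex_apply] at h2T ⊢
      change Affine.Point.map ι.toRatAlgHom (Affine.Point.some x' y' h') = _
      change (2 : ℕ) • Affine.Point.map ι.toRatAlgHom (Affine.Point.some x' y' h') = 0 at h2T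
      rw [Affine.Point.map_some] at h2T ⊢
      have hQ2 : (2 : ℕ) • (Affine.Point.some x y h : (W.baseChange ℂ).toAffine.Point) = 0 := by rw [two_nsmul]; exact hQ
      refine eq_of_X_eq_of_two_torsion (W := W) hQ2 ?_
      change ι.toRatAlgHom x' = x
      rw [hx', hi]; rfl
  rcases hx with hx | hx | hx
  · exact ⟨0, key 0 hx⟩
  · exact ⟨1, key 1 hx⟩
  · exact ⟨2, key 2 hx⟩

/-- **Every `2`-torsion point of `W(ℂ)` comes from a UNIQUE point of `W[2](ℚ̄)`** (existence §1, uniqueness: `geomPointsToComplex ι` is injective,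
coordinatewise). [cite: SilvermanAEC2009, Cor. III.6.4(b)] -/
theorem existsUnique_geomTorsion_eq {Q : (W.baseChange ℂ).toAffine.Point} (hQ : Q + Q = 0) :
    ∃! P : geomTorsion W (2 : ℤ), W.geomPointsToComplex ι (P : W.geomPoints) = Q := by
  have hinj : Function.Injective (W.geomPointsToComplex ι) := fun P P' hPP' ↦ by
    rw [WeierstrassCurve.geomPointsToComplex_apply, WeierstrassCurve.geomPointsToComplex_apply] at hPP'
    exact Affine.Point.map_injective (W' := W) _ hPP'
  by_cases hQ0 : Q = 0
  · refine ⟨0, ?_, fun P hP ↦ ?_⟩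
    · show W.geomPointsToComplex ι ((0 : geomTorsion W (2 : ℤ)) : W.geomPoints) = Q
      rw [hQ0, ZeroMemClass.coe_zero, map_zero]
    · have hP' : W.geomPointsToComplex ι (P : W.geomPoints) = W.geomPointsToComplex ι 0 := by
        rw [map_zero]; exact hP.trans hQ0
      exact Subtype.ext (hinj hP')
  · obtain ⟨i, hi⟩ := exists_T_geomPointsToComplex_eq W ι hQ0 hQ
    refine ⟨T W two_ne_zero i, hi, fun P hP ↦ Subtype.ext (hinj (hP.trans hi.symm))⟩

end Algebraicity

/-! ## §2 The transport theorem on half-classes `[x/2] ∈ J₀(N)[2]` -/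

section Transport

variable {N : ℕ} [NeZero N]

/-- The half-class `[x/2]` of `x ∈ Λ` is `2`-torsion in `J₀(N)`. [folklore] -/
theorem half_add_half_eq_zero {x : Module.Dual ℂ (CuspForm (Gamma0 N) 2)} (hx : x ∈ periodHomology N) :
    (Submodule.Quotient.mk ((2 : ℂ)⁻¹ • x) : J0 N) + Submodule.Quotient.mk ((2 : ℂ)⁻¹ • x) = 0 := by
  rw [← Submodule.Quotient.mk_add, ← add_smul, show ((2 : ℂ)⁻¹ + (2 : ℂ)⁻¹) = 1 by norm_num, one_smul,
    Submodule.Quotient.mk_eq_zero, mem_periodHomologyHecke]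
  exact hx

/-- Every `2`-torsion point of `J₀(N)` is a half-class `[x/2]`, `x ∈ Λ`. [folklore] -/
theorem exists_half_eq {q : J0 N} (hq : q + q = 0) :
    ∃ x ∈ periodHomology N, (Submodule.Quotient.mk ((2 : ℂ)⁻¹ • x) : J0 N) = q := by
  obtain ⟨φ, rfl⟩ := Submodule.Quotient.mk_surjective (periodHomologyHecke N) q
  refine ⟨(2 : ℂ) • φ, ?_, ?_⟩
  · rw [← mem_periodHomologyHecke, ← Submodule.Quotient.mk_eq_zero, two_smul, Submodule.Quotient.mk_add]
    exact hq
  · rw [smul_smul, inv_mul_cancel₀ (two_ne_zero : (2 : ℂ) ≠ 0), one_smul]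

variable {W : WeierstrassCurve ℚ} [W.IsElliptic] (D : ModularParametrizationData W N) (ι : AlgebraicClosure ℚ →+* ℂ)

omit [W.IsElliptic] in
/-- `jacobiMap` of a half-class is `2`-torsion in `W(ℂ)`. [folklore] -/
theorem jacobiMap_half_add_self {x : Module.Dual ℂ (CuspForm (Gamma0 N) 2)} (hx : x ∈ periodHomology N) :
    D.jacobiMap (Submodule.Quotient.mk ((2 : ℂ)⁻¹ • x)) + D.jacobiMap (Submodule.Quotient.mk ((2 : ℂ)⁻¹ • x)) = 0 := by
  rw [← map_add, half_add_half_eq_zero hx, map_zero]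

omit [W.IsElliptic] in
/-- `jacobiMap [x/2] = u_W(c·x(f)/2)`. [folklore] -/
theorem jacobiMap_half_eq {x : Module.Dual ℂ (CuspForm (Gamma0 N) 2)} :
    D.jacobiMap (Submodule.Quotient.mk ((2 : ℂ)⁻¹ • x)) = D.uniformize ((D.c : ℂ) * x D.f / 2) := by
  rw [ModularParametrizationData.jacobiMap_mk, LinearMap.smul_apply, smul_eq_mul]
  congr 1; ring

omit [W.IsElliptic] in
/-- **The Hecke eigen-relation on half-classes**: for a prime `q` and an integer `k` with `a_q(W) − a = 2k`, the half-class of `T_q^∨ x − a·x` goes to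
`O` under `jacobiMap D` (its image is `u_W(k · c·x(f)) = O`). [cite: CremonaAlgorithms1997, §2.10] -/
theorem jacobiMap_half_hecke_sub_eq_zero {x : Module.Dual ℂ (CuspForm (Gamma0 N) 2)} (hx : x ∈ periodHomology N)
    {q : ℕ} (hq : q.Prime) {a k : ℤ} (hk : W.LFunction q - a = 2 * k) :
    D.jacobiMap (Submodule.Quotient.mk ((2 : ℂ)⁻¹ •
      ((haveI : NeZero q := ⟨hq.ne_zero⟩; heckeT (Gamma0 N) 2 q).dualMap x - (a : ℂ) • x))) = 0 := by
  haveI : NeZero q := ⟨hq.ne_zero⟩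
  have hT : heckeT (Gamma0 N) 2 q D.f = ((W.LFunction q : ℤ) : ℂ) • D.f := by
    have h1 := D.isNewformOf.1.heckeT_eq_coeff_smul hq
    have h2 : cuspCoeff D.f q = (W.LFunction q : ℂ) := D.isNewformOf.2 q
    rw [cuspCoeff] at h2
    rw [h1, h2]
  rw [jacobiMap_half_eq, ModularParametrizationData.uniformize_eq_zero_iff]
  have heval : ((heckeT (Gamma0 N) 2 q).dualMap x - (a : ℂ) • x) D.f = ((W.LFunction q : ℤ) - a : ℂ) * x D.f := by
    rw [LinearMap.sub_apply, LinearMap.dualMap_apply, hT, map_smul, LinearMap.smul_apply, smul_eq_mul, smul_eq_mul]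
    ring
  rw [heval]
  have hmem := Summit.BirchSwinnertonDyer.BirchSwinnertonDyer.Theorems.AlignedTransportAtTwoDeltaPosFunctional.maninConstant_mul_eval_mem D hx
  have : (D.c : ℂ) * (((W.LFunction q : ℤ) - a : ℂ) * x D.f) / 2 = (k : ℂ) * ((D.c : ℂ) * x D.f) := by
    have hk' : ((W.LFunction q : ℤ) : ℂ) - (a : ℂ) = 2 * (k : ℂ) := by exact_mod_cast hk
    rw [hk']; ring
  rw [this]
  have := D.L.lattice.smul_mem k hmem
  rwa [zsmul_eq_mul] at this

/-- **MAIN (G1c): the two parametrisations transport half-classes to points that differ by THE equivariant isomorphism.** See the module docstring.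
Conditional on the carrier instance `J` (ask T1) and the PRINT Hecke pair. [cite: DarmonDiamondTaylor1995, §1.5 and §1.7]
[cite: Buzzard2000LevelLoweringModTwo, Prop. 2.4] -/
theorem jacobiMap_half_transport (J : ModularJacobianGaloisData N ι)
    (hSD : heckeSelfDual_torsionBy_J0) (hBz : buzzard2000_multiplicityOne_gamma0)
    {W₁ W₂ : WeierstrassCurve ℚ} [W₁.IsElliptic] [W₁.IsGloballyMinimal] [W₂.IsElliptic]
    (D₁ : ModularParametrizationData W₁ N) (D₂ : ModularParametrizationData W₂ N) (hN : Odd N)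
    (ht₁ : ∀ x : ℚ, ¬ HasRationalTwoTorsionX W₁ x) (ht₂ : ∀ x : ℚ, ¬ HasRationalTwoTorsionX W₂ x)
    (hΔ₁ : ∀ s : ℚ_[2], s ^ 2 ≠ (W₁.Δ : ℚ_[2])) (hΔ₂ : ¬ IsSquare W₂.Δ)
    (hgood₁ : ∀ v : HeightOneSpectrum (𝓞 ℚ), ¬ ((primesEquiv v : ℕ) ∣ 2 * N) → W₁.HasGoodReductionAt v)
    {F : Type*} [Field F] [Algebra ℚ F] [FiniteDimensional ℚ F] (hF : finrank ℚ F = 3)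
    {r₁ r₂ : F} (hr₁ : aeval r₁ (twoDivisionUCubic W₁) = 0) (hr₂ : aeval r₂ (twoDivisionUCubic W₂) = 0)
    (hpar : ∀ q : ℕ, q.Prime → ∃ k : ℤ, W₂.LFunction q - W₁.LFunction q = 2 * k)
    (hnz₁ : ∃ x ∈ periodHomology N, D₁.jacobiMap (Submodule.Quotient.mk ((2 : ℂ)⁻¹ • x)) ≠ 0)
    (hnz₂ : ∃ x ∈ periodHomology N, D₂.jacobiMap (Submodule.Quotient.mk ((2 : ℂ)⁻¹ • x)) ≠ 0)
    (e : geomTorsion W₁ (2 : ℤ) ≃+ geomTorsion W₂ (2 : ℤ))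
    (he : ∀ (σ : Field.absoluteGaloisGroup ℚ) (P : geomTorsion W₁ (2 : ℤ)), e (σ • P) = σ • e P)
    {x : Module.Dual ℂ (CuspForm (Gamma0 N) 2)} (hx : x ∈ periodHomology N) {P₁ : geomTorsion W₁ (2 : ℤ)}
    (hP₁ : D₁.jacobiMap (Submodule.Quotient.mk ((2 : ℂ)⁻¹ • x)) = W₁.geomPointsToComplex ι (P₁ : W₁.geomPoints)) :
    D₂.jacobiMap (Submodule.Quotient.mk ((2 : ℂ)⁻¹ • x)) = W₂.geomPointsToComplex ι ((e P₁ : geomTorsion W₂ (2 : ℤ)) : W₂.geomPoints) := by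
  -- notation
  set Λ := periodHomology N with hΛ
  let half : Module.Dual ℂ (CuspForm (Gamma0 N) 2) → J0 N := fun z ↦ Submodule.Quotient.mk ((2 : ℂ)⁻¹ • z)
  have half_add : ∀ z z', half (z + z') = half z + half z' := fun z z' ↦ by
    simp only [half, smul_add, Submodule.Quotient.mk_add]
  -- the maps `θᵢ : Λ → Wᵢ[2]` through `existsUnique_geomTorsion_eq`
  have hex₁ : ∀ z : Λ, ∃! P : geomTorsion W₁ (2 : ℤ), W₁.geomPointsToComplex ι (P : W₁.geomPoints) = D₁.jacobiMap (half z) :=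
    fun z ↦ existsUnique_geomTorsion_eq W₁ ι (jacobiMap_half_add_self D₁ z.2)
  have hex₂ : ∀ z : Λ, ∃! P : geomTorsion W₂ (2 : ℤ), W₂.geomPointsToComplex ι (P : W₂.geomPoints) = D₂.jacobiMap (half z) :=
    fun z ↦ existsUnique_geomTorsion_eq W₂ ι (jacobiMap_half_add_self D₂ z.2)
  choose θ₁f hθ₁f using fun z ↦ (hex₁ z).exists
  choose θ₂f hθ₂f using fun z ↦ (hex₂ z).exists
  have uniq₁ : ∀ (z : Λ) (P : geomTorsion W₁ (2 : ℤ)), W₁.geomPointsToComplex ι (P : W₁.geomPoints) = D₁.jacobiMap (half z) → P = θ₁f z :=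
    fun z P hP ↦ (hex₁ z).unique hP (hθ₁f z)
  have uniq₂ : ∀ (z : Λ) (P : geomTorsion W₂ (2 : ℤ)), W₂.geomPointsToComplex ι (P : W₂.geomPoints) = D₂.jacobiMap (half z) → P = θ₂f z :=
    fun z P hP ↦ (hex₂ z).unique hP (hθ₂f z)
  let θ₁ : Λ →+ geomTorsion W₁ (2 : ℤ) :=
    { toFun := θ₁f
      map_zero' := by
        symm; apply uniq₁
        have h0 : half 0 = 0 := by simp only [half, smul_zero, Submodule.Quotient.mk_zero]
        rw [ZeroMemClass.coe_zero, map_zero, ZeroMemClass.coe_zero, h0, map_zero]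
      map_add' := fun z z' ↦ by
        symm; apply uniq₁
        rw [AddSubgroup.coe_add, map_add, hθ₁f, hθ₁f, AddSubgroup.coe_add, half_add, map_add] }
  let θ₂ : Λ →+ geomTorsion W₂ (2 : ℤ) :=
    { toFun := θ₂f
      map_zero' := by
        symm; apply uniq₂
        have h0 : half 0 = 0 := by simp only [half, smul_zero, Submodule.Quotient.mk_zero]
        rw [ZeroMemClass.coe_zero, map_zero, ZeroMemClass.coe_zero, h0, map_zero]
      map_add' := fun z z' ↦ by
        symm; apply uniq₂
        rw [AddSubgroup.coe_add, map_add, hθ₂f, hθ₂f, AddSubgroup.coe_add, half_add, map_add] }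
  have hθ₁_apply : ∀ z, θ₁ z = θ₁f z := fun _ ↦ rfl
  have hθ₂_apply : ∀ z, θ₂ z = θ₂f z := fun _ ↦ rfl
  -- the torsion points `⟨half z⟩ ∈ J0.tors N` and the lifted Galois action on `Λ`
  have htors : ∀ z : Λ, half z ∈ J0.tors N := fun z ↦ by
    rw [J0.mem_tors_iff, isOfFinAddOrder_iff_nsmul_eq_zero]
    exact ⟨2, two_pos, by rw [two_nsmul]; exact half_add_half_eq_zero z.2⟩
  have hlift : ∀ (σ : Field.absoluteGaloisGroup ℚ) (z : Λ), ∃ z' : Λ,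
      half z' = ((J.galAct σ ⟨half z, htors z⟩ : J0.tors N) : J0 N) := by
    intro σ z
    set t : J0.tors N := J.galAct σ ⟨half z, htors z⟩ with ht
    have htt : (t : J0 N) + (t : J0 N) = 0 := by
      rw [← Submodule.coe_add, ht, ← map_add]
      have : (⟨half z, htors z⟩ : J0.tors N) + ⟨half z, htors z⟩ = 0 := Subtype.ext (half_add_half_eq_zero z.2)
      rw [this, map_zero, Submodule.coe_zero]
    obtain ⟨z', hz', hz'eq⟩ := exists_half_eq htt
    exact ⟨⟨z', hz'⟩, hz'eq⟩
  choose act hact using hlift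
  -- equivariance
  have hθ₁ : ∀ (σ : Field.absoluteGaloisGroup ℚ) (z : Λ), θ₁ (act σ z) = σ • θ₁ z := by
    intro σ z
    symm
    rw [hθ₁_apply, hθ₁_apply]
    apply uniq₁
    rw [AddSubgroup.torsionBy.coe_smul, hact σ z]
    exact (J.jacobiMap_galAct W₁ D₁ σ ⟨half z, htors z⟩ (θ₁f z : W₁.geomPoints) (hθ₁f z).symm).symm
  have hθ₂ : ∀ (σ : Field.absoluteGaloisGroup ℚ) (z : Λ), θ₂ (act σ z) = σ • θ₂ z := by
    intro σ z
    symm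
    rw [hθ₂_apply, hθ₂_apply]
    apply uniq₂
    rw [AddSubgroup.torsionBy.coe_smul, hact σ z]
    exact (J.jacobiMap_galAct W₂ D₂ σ ⟨half z, htors z⟩ (θ₂f z : W₂.geomPoints) (hθ₂f z).symm).symm
  -- non-vanishing
  have h0 : ∀ {W' : WeierstrassCurve ℚ} [W'.IsElliptic] (D' : ModularParametrizationData W' N) (θf : Λ → geomTorsion W' (2 : ℤ))
      (hθf : ∀ z, W'.geomPointsToComplex ι (θf z : W'.geomPoints) = D'.jacobiMap (half z))
      (hnz : ∃ z ∈ periodHomology N, D'.jacobiMap (Submodule.Quotient.mk ((2 : ℂ)⁻¹ • z)) ≠ 0), ∃ z, θf z ≠ 0 := by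
    intro W' _ D' θf hθf hnz
    obtain ⟨z, hz, hne⟩ := hnz
    refine ⟨⟨z, hz⟩, fun h0 ↦ hne ?_⟩
    have := hθf ⟨z, hz⟩
    rw [h0, ZeroMemClass.coe_zero, map_zero] at this
    exact this.symm
  have h0₁ : ∃ z, θ₁ z ≠ 0 := h0 D₁ θ₁f hθ₁f hnz₁
  have h0₂ : ∃ z, θ₂ z ≠ 0 := h0 D₂ θ₂f hθ₂f hnz₂
  -- the common kernel `K` and its index bound
  set K : AddSubgroup Λ := θ₁.ker ⊓ θ₂.ker with hK
  have hmemK : ∀ (z : Module.Dual ℂ (CuspForm (Gamma0 N) 2)) (hz : z ∈ Λ),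
      D₁.jacobiMap (half z) = 0 → D₂.jacobiMap (half z) = 0 → (⟨z, hz⟩ : Λ) ∈ K := by
    intro z hz h1 h2
    refine AddSubgroup.mem_inf.mpr ⟨?_, ?_⟩
    · rw [AddMonoidHom.mem_ker, hθ₁_apply]; symm; apply uniq₁
      rw [ZeroMemClass.coe_zero, map_zero]; exact h1.symm
    · rw [AddMonoidHom.mem_ker, hθ₂_apply]; symm; apply uniq₂
      rw [ZeroMemClass.coe_zero, map_zero]; exact h2.symm
  set KΛ : AddSubgroup (Module.Dual ℂ (CuspForm (Gamma0 N) 2)) := K.map Λ.subtype with hKΛ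
  have hKΛmem : ∀ (z : Module.Dual ℂ (CuspForm (Gamma0 N) 2)) (hz : z ∈ Λ), (⟨z, hz⟩ : Λ) ∈ K → z ∈ KΛ :=
    fun z hz h ↦ ⟨⟨z, hz⟩, h, rfl⟩
  have h2K : ∀ z ∈ periodHomology N, (2 : ℂ) • z ∈ KΛ := by
    intro z hz
    have h2z : (2 : ℂ) • z ∈ Λ := by
      have := Λ.nsmul_mem hz 2
      rwa [← Nat.cast_smul_eq_nsmul ℂ, Nat.cast_ofNat] at this
    have hhalf : half ((2 : ℂ) • z) = 0 := by
      simp only [half, smul_smul, inv_mul_cancel₀ (two_ne_zero : (2 : ℂ) ≠ 0), one_smul]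
      rw [Submodule.Quotient.mk_eq_zero, mem_periodHomologyHecke]; exact hz
    exact hKΛmem _ h2z (hmemK _ h2z (by rw [hhalf, map_zero]) (by rw [hhalf, map_zero]))
  have hTK : ∀ (q : ℕ) (hq : q.Prime), ∀ z ∈ periodHomology N,
      (haveI : NeZero q := ⟨hq.ne_zero⟩; heckeT (Gamma0 N) 2 q).dualMap z - (W₁.LFunction q : ℂ) • z ∈ KΛ := by
    intro q hq z hz
    haveI : NeZero q := ⟨hq.ne_zero⟩
    have hmemΛ : (heckeT (Gamma0 N) 2 q).dualMap z - (W₁.LFunction q : ℂ) • z ∈ Λ := by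
      refine Λ.sub_mem (dualMap_heckeT_mem_periodHomology N hq hz) ?_
      have := Λ.zsmul_mem hz (W₁.LFunction q)
      rwa [← Int.cast_smul_eq_zsmul ℂ] at this
    obtain ⟨k, hk⟩ := hpar q hq
    refine hKΛmem _ hmemΛ (hmemK _ hmemΛ ?_ ?_)
    · exact jacobiMap_half_hecke_sub_eq_zero D₁ hz hq (a := W₁.LFunction q) (k := 0) (by ring)
    · exact jacobiMap_half_hecke_sub_eq_zero D₂ hz hq (a := W₁.LFunction q) (k := k) hk
  have hidx := index_le_four_newformLevel hSD hBz W₁ ht₁ hΔ₁ D₁.isNewformOf hN hgood₁ KΛ h2K hTK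
  have hKeq : KΛ.addSubgroupOf Λ = K := by
    rw [hKΛ, AddSubgroup.addSubgroupOf, AddSubgroup.comap_map_eq_self_of_injective]
    exact Subtype.val_injective
  rw [hKeq] at hidx
  -- the factorisation through THE equivariant isomorphism
  have hcomp := comp_eq_of_sharedCubicField (W₁ := W₁) (W₂ := W₂) hF ht₁ ht₂ hΔ₂ hr₁ hr₂ act θ₁ θ₂ hθ₁ hθ₂ h0₁ h0₂
    K inf_le_left inf_le_right hidx.1 hidx.2 e he
  -- conclude at `x`
  have hP₁' : P₁ = θ₁f ⟨x, hx⟩ := uniq₁ ⟨x, hx⟩ P₁ hP₁.symm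
  have := hθ₂f ⟨x, hx⟩
  rw [← hθ₂_apply, hcomp ⟨x, hx⟩, hθ₁_apply, ← hP₁'] at this
  exact this.symm

end Transport

end Summit.BirchSwinnertonDyer.BirchSwinnertonDyer.Theorems.AlignedTransportAtTwoDeltaPosJacobian

end
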